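import Mathlib.Algebra.Polynomial.Inductions
import Mathlib.Algebra.Polynomial.Coeff
import Mathlib.Data.Nat.Choose.Sum
import Mathlib.Data.Nat.Factorization.Basic
import Mathlib.LinearAlgebra.FiniteDimensional.Lemmas
import Mathlib.Algebra.Field.ZMod
import Literature.Computability.MetaComplexity.SmolenskyProperty
import HarnessLib

/-!
# The immunity of `¬MOD_q` over `𝔽_p` is `⌊(n+q-1)/q⌋` (Beck–Li 2013, Theorem 5.2)

Beck–Li, *Represent MOD function by low degree polynomial with unbounded one-sided error*
(arXiv:1304.0713, 2013), §§4–5, in the "Razborov–Smolensky ring"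
`R = 𝔽_p[x₁,…,xₙ]/(xᵢ² = xᵢ)` (= the tree's `Smolensky.CubeFn (ZMod p) n` with the degree
filtration `Smolensky.lowDeg`; `χ_q(x) = 1` iff `q ∣ |x|`, Def. 3.1, and `f ∈ ⟨¬χ_q⟩` iff
`f = f·¬χ_q` iff `f` vanishes at every `x` with `q ∣ |x|`, Obs. 3.2):

* **Theorem 5.2** (held text `paper:arxiv-1304.0713` p0007:L106–107, verbatim): "Let `p` be a
  prime, and `q ≥ 2` an integer coprime to `p`. The immunity of `¬χ_q` over `F_p` is
  `⌊(n+q-1)/q⌋`, which is independent of `p`." (immunity = "the minimal degree of a nonzero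
  function in the ideal `⟨¬χ_q⟩`", p0007:L104).
* Its proof: **Lemma 4.1** (p0006:L13, symmetrisation — for a symmetric `f`, a lowest-degree
  `g ∈ ⟨f⟩` may be taken of the form `g' · Π (x_{2i-1} - x_{2i})` with `g'` symmetric; proof:
  `g - π(g) = (x_i - x_j)(g_1 - g_2)` for a transposition `π = (i j)`), **Corollary 4.2**
  (p0006:L59, the restrictions `ρ` setting `x_{2i-1} = 0`, `x_{2i} = 1`), **Lemma 5.1** (p0007:L55,
  "Vectors `ψ_d(a), ψ_d(a+q), …, ψ_d(a+(d-1)q) ∈ F_p^d` is a basis", `ψ_d(i) = (binom(i,0), …,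
  binom(i,d-1))`), and the computation `min{⌊n/q⌋ + 1, ⌊(n-i)/q⌋ - ⌊(i-1)/q⌋ + i} = ⌊(n+q-1)/q⌋`.

WHAT IS TYPED (namespace `…MetaComplexity.Smolensky`; both halves of the printed equality —
the lower bound `beckLi2013_thm52` (the half used downstream) and the attainment
`beckLi2013_thm52_attained` (§6); "immunity" itself is not introduced as a notion):

* §0 `monoOn` / `lowDegOn F ι D` / `hwt` / `indVec` — monomials, the degree filtration and the
  Hamming weight on `{0,1}^ι` for an ARBITRARY finite index type `ι` (the descent removes
  variables); `lowDeg_eq_lowDegOn : lowDeg F n D = lowDegOn F (Fin n) D` is `rfl`.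
* §1 `eq_of_hwt_eq_of_swap_invariant` — a function invariant under all transpositions depends
  only on `|x|` (`S_n` is generated by transpositions).
* §2 `pairExt` / `descend` / `descend_mem_lowDegOn` / `descend_eq_zero_of_dvd` /
  `descend_restrict` — the descent `g ↦ (g - (i j)g)/(x_i - x_j)` of Lemma 4.1: it lowers the
  degree by one, preserves membership in the (shifted) ideal, and is non-zero at a witness of
  non-symmetry.
* §3 `mcoeff` / `moebius_inversion` / `mcoeff_eq_zero_of_mem_lowDegOn` / `exists_binomial_rep` —
  Möbius inversion on the cube [Jukna, *Boolean Function Complexity*, §2.1 eq. (2.1)] and the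
  representation `g(x) = Σ_{k ≤ t} C_k binom(|x|, k)` of a symmetric function of degree `≤ t`
  (the paper's `g = Σ_{i<d} c_i σ_i`).
* §4 `beckLi2013_lemma51` — Lemma 5.1 over any field in which `q` is invertible (proof here via
  `F[X]`: the functional `Σ_k c_k coeff_k` kills `(X+1)^a((X+1)^q - 1)^k = X^k·(q^k + …)`, a
  triangular system; the printed proof computes the determinant `q^{d(d-1)/2}`).
* §5 `eq_zero_of_lowDegOn_of_forall_dvd_hwt` — the symmetrisation argument in general form (any
  field with `q` invertible, any shift `s` of the weights, hypothesis: an arithmetic progression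
  `a, a+q, …, a+(t-ℓ)q` of admissible weights inside `[ℓ, |ι|-ℓ]` for every `ℓ ≤ t`);
  `eq_zero_of_lowDeg_of_forall_dvd_card` — `q ≥ 2` invertible in `F`, `q·t < n`, `f ∈ lowDeg F n t`
  vanishing on `{x : q ∣ |x|}` ⟹ `f = 0`; **`beckLi2013_thm52`** — the printed setting `F = 𝔽_p`,
  `p ∤ q`, degree `t < ⌊(n+q-1)/q⌋`; `beckLi2013_thm52'` — the same with `q·t < n`.
* §6 `exists_ne_zero_mem_lowDeg_forall_dvd_card` / **`beckLi2013_thm52_attained`** — the upper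
  bound: for `q ≥ 2`, `n ≥ 1` and ANY field, a non-zero `f` of degree `≤ ⌊(n+q-1)/q⌋` vanishing
  on `{x : q ∣ |x|}` (the printed construction via Corollary 4.2 with `ℓ = 1`:
  `f = (x₁ - x₂)·Σ_{k ≤ d} c_k σ_k(x₃,…,xₙ)`, `d = ⌊(n-1)/q⌋`, `c ≠ 0` from `d` linear conditions in
  `d + 1` unknowns — `LinearMap.ker_ne_bot_of_finrank_lt` — and `f ≠ 0` by Lemma 5.1 with
  difference `1`).

0 facts, 0 sorry; companion of `ModqImmunity.lean` (Theorem 3.4, the immunity of `MOD_q`).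

## References

* C. Beck, Y. Li, *Represent MOD function by low degree polynomial with unbounded one-sided
  error*, arXiv:1304.0713 (2013), Def. 3.1, Obs. 3.2, Lemma 4.1, Cor. 4.2, Lemma 5.1, Thm. 5.2
  [BeckLi2013].
* S. Jukna, *Boolean Function Complexity*, Springer 2012, §2.1 eq. (2.1) (Möbius inversion /
  the unique multilinear representation) [JuknaBFC2012].
* R. Smolensky, *Algebraic methods in the theory of lower bounds for Boolean circuit complexity*,
  STOC 1987, p. 78 (the algebra `U_F^n`, monomials, `deg`) [Smolensky1987].
-/

noncomputable section

open Finset Polynomial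

namespace Literature.Computability.MetaComplexity

namespace Smolensky

/-! ### §0 Functions on the cube `{0,1}^ι` over an arbitrary finite set `ι` of variables -/

section General

variable {F : Type*} [Field F] {ι : Type*}

/-- The multilinear monomial `x_S = Π_{i ∈ S} xᵢ` as a function on the cube `{0,1}^ι`, for an
arbitrary index type `ι` of variables (the tree's `mono` is the case `ι = Fin n`).
[cite: Smolensky1987, p. 78 (Basic notation: polynomials in U_F^n)] -/
def monoOn (F : Type*) [Field F] {ι : Type*} (S : Finset ι) : (ι → Bool) → F :=
  fun b => ∏ i ∈ S, (if b i then (1 : F) else 0)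

/-- `x_S(b) = 1` if `bᵢ = 1` for all `i ∈ S`, and `0` otherwise.
[cite: Smolensky1987, p. 78 (Basic notation: polynomials in U_F^n)] -/
theorem monoOn_apply (S : Finset ι) (b : ι → Bool) :
    monoOn F S b = if ∀ i ∈ S, b i = true then 1 else 0 := by
  unfold monoOn
  rw [Finset.prod_boole]

/-- The degree filtration on functions on `{0,1}^ι`: the span of the monomials `x_S`, `|S| ≤ D`
(the tree's `lowDeg` is the case `ι = Fin n`, see `lowDeg_eq_lowDegOn`).
[cite: Smolensky1987, p. 78 (Basic notation: deg_A)] -/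
def lowDegOn (F : Type*) [Field F] (ι : Type*) (D : ℕ) : Submodule F ((ι → Bool) → F) :=
  Submodule.span F (Set.range fun S : {S : Finset ι // S.card ≤ D} => monoOn F S.1)

/-- The tree's degree filtration `lowDeg F n D` on `CubeFn F n = (Fin n → Bool) → F` is `lowDegOn`
for `ι = Fin n` (definitionally). [cite: Smolensky1987, p. 78 (Basic notation: deg_A)] -/
theorem lowDeg_eq_lowDegOn (n D : ℕ) : lowDeg F n D = lowDegOn F (Fin n) D := rfl

/-- A monomial of degree `≤ D` lies in `lowDegOn D`. [cite: Smolensky1987, p. 78 (deg_A)] -/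
theorem monoOn_mem_lowDegOn {S : Finset ι} {D : ℕ} (h : S.card ≤ D) :
    monoOn F S ∈ lowDegOn F ι D :=
  Submodule.subset_span ⟨⟨S, h⟩, rfl⟩

/-- The Hamming weight `|b|` of a point of the cube (number of coordinates equal to `1`).
[cite: BeckLi2013, §2 (notation |x|) and Definition 3.1] -/
def hwt [Fintype ι] (b : ι → Bool) : ℕ := (univ.filter fun i => b i = true).card

/-- The indicator vector `1_T ∈ {0,1}^ι` of a finite set `T` of coordinates.
[cite: JuknaBFC2012, §2.1 (eq. (2.1), Möbius inversion)] -/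
def indVec [DecidableEq ι] (T : Finset ι) : ι → Bool := fun k => decide (k ∈ T)

/-- Unfolding `indVec`. [cite: JuknaBFC2012, §2.1 (eq. (2.1))] -/
theorem indVec_apply [DecidableEq ι] (T : Finset ι) (k : ι) :
    indVec T k = decide (k ∈ T) := rfl

/-- `x_S(1_T) = [S ⊆ T]`. [cite: JuknaBFC2012, §2.1 (eq. (2.1), Möbius inversion)] -/
theorem monoOn_indVec [DecidableEq ι] (S T : Finset ι) :
    monoOn F S (indVec T) = if S ⊆ T then 1 else 0 := by
  rw [monoOn_apply]
  by_cases h : S ⊆ T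
  · rw [if_pos h, if_pos]
    intro i hi
    simpa [indVec] using h hi
  · rw [if_neg h, if_neg]
    intro h'
    exact h fun i hi => by simpa [indVec] using h' i hi

/-- `|1_T| = |T|`. [cite: BeckLi2013, §2 (notation |x|)] -/
theorem hwt_indVec [Fintype ι] [DecidableEq ι] (T : Finset ι) : hwt (indVec T) = T.card := by
  unfold hwt
  congr 1
  ext k
  simp [indVec]

/-- The indicator vector of the support of `b` is `b`. [cite: BeckLi2013, §2 (notation |x|)] -/
theorem indVec_support [Fintype ι] [DecidableEq ι] (b : ι → Bool) :
    indVec (univ.filter fun i => b i = true) = b := by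
  funext k
  simp [indVec]

/-- The Hamming weight is invariant under permuting the coordinates.
[cite: BeckLi2013, §4 (symmetric functions)] -/
theorem hwt_comp_equiv [Fintype ι] (x : ι → Bool) (σ : Equiv.Perm ι) : hwt (x ∘ σ) = hwt x := by
  unfold hwt
  refine Finset.card_bij (fun k _ => σ k) (fun k hk => ?_) (fun a _ b _ h => σ.injective h)
    (fun k hk => ⟨σ.symm k, ?_, σ.apply_symm_apply k⟩)
  · simpa using hk
  · simpa using hk

/-! ### §1 Swap-invariance: a function invariant under all transpositions depends only on `|x|` -/

/-- Two distinct points of equal weight differ at a coordinate where the first is `1` and the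
second is `0`. [cite: BeckLi2013, §4 (proof of Lemma 4.1: `S_n` is generated by transpositions)] -/
theorem exists_true_false_of_hwt_eq [Fintype ι] {x x' : ι → Bool} (hw : hwt x = hwt x')
    (hne : x ≠ x') : ∃ i, x i = true ∧ x' i = false := by
  by_contra h
  push Not at h
  have hsub : (univ.filter fun k => x k = true) ⊆ (univ.filter fun k => x' k = true) := by
    intro k hk
    simp only [mem_filter, mem_univ, true_and] at hk ⊢
    simpa using h k hk
  have heq := Finset.eq_of_subset_of_card_le hsub (by unfold hwt at hw; rw [hw])
  apply hne
  funext k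
  have hk : x k = true ↔ x' k = true := by
    constructor
    · intro hk
      have := hsub (by simpa using hk)
      simpa using this
    · intro hk
      have : k ∈ univ.filter fun k => x k = true := by rw [heq]; simpa using hk
      simpa using this
  exact Bool.eq_iff_iff.mpr hk

omit [Field F] in
/-- A function on the cube invariant under every transposition of coordinates `(i j)` (it is
enough to test points with `x_i = 1`, `x_j = 0`) depends only on the Hamming weight.
[cite: BeckLi2013, §4 (proof of Lemma 4.1: `S_n` is generated by transpositions)] -/
theorem eq_of_hwt_eq_of_swap_invariant [Fintype ι] [DecidableEq ι] {g : (ι → Bool) → F}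
    (hg : ∀ i j : ι, i ≠ j → ∀ x : ι → Bool, x i = true → x j = false →
      g (x ∘ Equiv.swap i j) = g x)
    (x x' : ι → Bool) (hw : hwt x = hwt x') : g x = g x' := by
  suffices h : ∀ (d : ℕ) (x : ι → Bool), hwt x = hwt x' →
      (univ.filter fun k => x k ≠ x' k).card = d → g x = g x' from h _ x hw rfl
  intro d
  induction d using Nat.strong_induction_on with
  | _ d ih =>
    intro x hw hd
    by_cases hne : x = x'
    · rw [hne]
    obtain ⟨i, hi, hi'⟩ := exists_true_false_of_hwt_eq hw hne
    obtain ⟨j, hj', hj⟩ := exists_true_false_of_hwt_eq hw.symm (Ne.symm hne)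
    have hij : i ≠ j := by
      rintro rfl
      rw [hi] at hj
      exact Bool.noConfusion hj
    have hlt : (univ.filter fun k => (x ∘ Equiv.swap i j) k ≠ x' k).card < d := by
      rw [← hd]
      apply Finset.card_lt_card
      rw [Finset.ssubset_iff_of_subset]
      · refine ⟨i, ?_, ?_⟩
        · simp [hi, hi']
        · simp [Function.comp, Equiv.swap_apply_left, hj, hi']
      · intro k hk
        simp only [mem_filter, mem_univ, true_and, Function.comp] at hk ⊢
        by_cases hki : k = i
        · subst hki
          rw [Equiv.swap_apply_left, hj, hi'] at hk
          exact absurd rfl hk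
        · by_cases hkj : k = j
          · subst hkj
            rw [Equiv.swap_apply_right, hi, hj'] at hk
            exact absurd rfl hk
          · rwa [Equiv.swap_apply_of_ne_of_ne hki hkj] at hk
    rw [← hg i j hij x hi hj]
    exact ih _ hlt (x ∘ Equiv.swap i j) (by rw [hwt_comp_equiv]; exact hw) rfl

/-! ### §2 The symmetrisation descent `g ↦ (g - (i j)·g)/(x_i - x_j)` (Beck–Li, Lemma 4.1) -/

variable [DecidableEq ι]

/-- Extend a point `y` of the cube on the variables `≠ i, j` by `x_i = bi`, `x_j = bj`.
[cite: BeckLi2013, §4, Lemma 4.1 (proof: `g = g₀ + g₁xᵢ + g₂xⱼ + g₃xᵢxⱼ`) and Corollary 4.2 (the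
restriction `ρ`)] -/
def pairExt (i j : ι) (bi bj : Bool) (y : {k : ι // k ≠ i ∧ k ≠ j} → Bool) : ι → Bool :=
  fun k => if hi : k = i then bi else if hj : k = j then bj else y ⟨k, hi, hj⟩

/-- The extended point has `x_i = bi`. [cite: BeckLi2013, §4, Lemma 4.1 (proof)] -/
theorem pairExt_apply_left (i j : ι) (bi bj : Bool) (y : {k : ι // k ≠ i ∧ k ≠ j} → Bool) :
    pairExt i j bi bj y i = bi := by
  simp [pairExt]

/-- The extended point has `x_j = bj`. [cite: BeckLi2013, §4, Lemma 4.1 (proof)] -/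
theorem pairExt_apply_right {i j : ι} (hij : i ≠ j) (bi bj : Bool)
    (y : {k : ι // k ≠ i ∧ k ≠ j} → Bool) : pairExt i j bi bj y j = bj := by
  simp [pairExt, hij.symm]

/-- The extended point agrees with `y` off `{i, j}`. [cite: BeckLi2013, §4, Lemma 4.1 (proof)] -/
theorem pairExt_apply_coe (i j : ι) (bi bj : Bool) (y : {k : ι // k ≠ i ∧ k ≠ j} → Bool)
    (k : {k : ι // k ≠ i ∧ k ≠ j}) : pairExt i j bi bj y k = y k := by
  simp [pairExt, k.2.1, k.2.2]

/-- The descent of Beck–Li's symmetrisation: `y ↦ g(y; x_i = 1, x_j = 0) - g(y; x_i = 0, x_j = 1)`,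
i.e. `(g - π(g))/(x_i - x_j)` for the transposition `π = (i j)`, a function on the cube of the
remaining variables.
[cite: BeckLi2013, §4, Lemma 4.1 (proof: `g - π(g) = (x_i - x_j)(g_1 - g_2)`)] -/
def descend (i j : ι) (g : (ι → Bool) → F) : ({k : ι // k ≠ i ∧ k ≠ j} → Bool) → F :=
  fun y => g (pairExt i j true false y) - g (pairExt i j false true y)

/-- The descent is `F`-linear in `g`. [cite: BeckLi2013, §4, Lemma 4.1 (proof)] -/
def descendLinear (i j : ι) :
    ((ι → Bool) → F) →ₗ[F] (({k : ι // k ≠ i ∧ k ≠ j} → Bool) → F) where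
  toFun := descend i j
  map_add' g h := by
    funext y
    simp only [descend, Pi.add_apply]
    ring
  map_smul' r g := by
    funext y
    simp only [descend, Pi.smul_apply, smul_eq_mul, RingHom.id_apply]
    ring

/-- Unfolding `descendLinear`. [cite: BeckLi2013, §4, Lemma 4.1 (proof)] -/
theorem descendLinear_apply (i j : ι) (g : (ι → Bool) → F) :
    descendLinear (F := F) i j g = descend i j g := rfl

/-- A monomial `x_S` evaluated at an extended point: zero if a variable of `S` is set to `0`,
otherwise the monomial on `S ∖ {i, j}`. [cite: BeckLi2013, §4, Lemma 4.1 (proof)] -/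
theorem forall_pairExt_iff {i j : ι} (hij : i ≠ j) (S : Finset ι) (bi bj : Bool)
    (y : {k : ι // k ≠ i ∧ k ≠ j} → Bool) :
    (∀ k ∈ S, pairExt i j bi bj y k = true) ↔
      ((i ∈ S → bi = true) ∧ (j ∈ S → bj = true)) ∧
        ∀ k ∈ S.subtype (fun k => k ≠ i ∧ k ≠ j), y k = true := by
  constructor
  · intro h
    refine ⟨⟨fun hi => ?_, fun hj => ?_⟩, fun k hk => ?_⟩
    · simpa [pairExt_apply_left] using h i hi
    · simpa [pairExt_apply_right hij] using h j hj
    · rw [Finset.mem_subtype] at hk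
      simpa [pairExt_apply_coe] using h k hk
  · rintro ⟨⟨hi, hj⟩, h⟩ k hk
    by_cases hki : k = i
    · subst hki
      rw [pairExt_apply_left]
      exact hi hk
    · by_cases hkj : k = j
      · subst hkj
        rw [pairExt_apply_right hij]
        exact hj hk
      · have e := pairExt_apply_coe i j bi bj y ⟨k, hki, hkj⟩
        have := h ⟨k, hki, hkj⟩ (by rw [Finset.mem_subtype]; exact hk)
        rw [← e] at this
        exact this

/-- `x_S(y; x_i = bi, x_j = bj)`. [cite: BeckLi2013, §4, Lemma 4.1 (proof)] -/
theorem monoOn_pairExt {i j : ι} (hij : i ≠ j) (S : Finset ι) (bi bj : Bool)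
    (y : {k : ι // k ≠ i ∧ k ≠ j} → Bool) :
    monoOn F S (pairExt i j bi bj y) =
      if (i ∈ S → bi = true) ∧ (j ∈ S → bj = true) then
        monoOn F (S.subtype fun k => k ≠ i ∧ k ≠ j) y else 0 := by
  rw [monoOn_apply, monoOn_apply]
  have hiff := forall_pairExt_iff hij S bi bj y
  by_cases hA : (i ∈ S → bi = true) ∧ (j ∈ S → bj = true)
  · rw [if_pos hA]
    by_cases hB : ∀ k ∈ S.subtype (fun k => k ≠ i ∧ k ≠ j), y k = true
    · rw [if_pos hB, if_pos (hiff.2 ⟨hA, hB⟩)]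
    · rw [if_neg hB, if_neg fun h => hB (hiff.1 h).2]
  · rw [if_neg hA, if_neg fun h => hA (hiff.1 h).1]

/-- The descent of a monomial. [cite: BeckLi2013, §4, Lemma 4.1 (proof)] -/
theorem descend_monoOn {i j : ι} (hij : i ≠ j) (S : Finset ι) :
    descend i j (monoOn F S) =
      (if j ∈ S then 0 else monoOn F (S.subtype fun k => k ≠ i ∧ k ≠ j)) -
        (if i ∈ S then 0 else monoOn F (S.subtype fun k => k ≠ i ∧ k ≠ j)) := by
  funext y
  simp only [descend, monoOn_pairExt hij, Pi.sub_apply]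
  by_cases hi : i ∈ S <;> by_cases hj : j ∈ S <;> simp [hi, hj]

/-- If `i ∈ S` and `j ∉ S` then `S ∖ {i, j}` has `|S| - 1` elements.
[cite: BeckLi2013, §4, Lemma 4.1 (proof: `deg h = deg g - 1`)] -/
theorem card_subtype_ne_of_mem_of_notMem {i j : ι} {S : Finset ι} (hi : i ∈ S) (hj : j ∉ S) :
    (S.subtype fun k => k ≠ i ∧ k ≠ j).card = S.card - 1 := by
  rw [Finset.card_subtype]
  have : S.filter (fun k => k ≠ i ∧ k ≠ j) = S.erase i := by
    ext k
    simp only [mem_filter, mem_erase]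
    constructor
    · rintro ⟨hk, hki, -⟩
      exact ⟨hki, hk⟩
    · rintro ⟨hki, hk⟩
      exact ⟨hk, hki, fun h => hj (h ▸ hk)⟩
  rw [this, Finset.card_erase_of_mem hi]

/-- If `i ∉ S` and `j ∈ S` then `S ∖ {i, j}` has `|S| - 1` elements.
[cite: BeckLi2013, §4, Lemma 4.1 (proof: `deg h = deg g - 1`)] -/
theorem card_subtype_ne_of_notMem_of_mem {i j : ι} {S : Finset ι} (hi : i ∉ S) (hj : j ∈ S) :
    (S.subtype fun k => k ≠ i ∧ k ≠ j).card = S.card - 1 := by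
  rw [Finset.card_subtype]
  have : S.filter (fun k => k ≠ i ∧ k ≠ j) = S.erase j := by
    ext k
    simp only [mem_filter, mem_erase]
    constructor
    · rintro ⟨hk, -, hkj⟩
      exact ⟨hkj, hk⟩
    · rintro ⟨hkj, hk⟩
      exact ⟨hk, fun h => hi (h ▸ hk), hkj⟩
  rw [this, Finset.card_erase_of_mem hj]

/-- **Degree drop of the descent**: if `deg g ≤ t` then `deg (descend g) ≤ t - 1`.
[cite: BeckLi2013, §4, Lemma 4.1 (proof: `g - π(g) = (x_i - x_j) h`, `deg h = deg g - 1`)] -/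
theorem descend_mem_lowDegOn {i j : ι} (hij : i ≠ j) {t : ℕ} {g : (ι → Bool) → F}
    (hg : g ∈ lowDegOn F ι t) :
    descend i j g ∈ lowDegOn F {k : ι // k ≠ i ∧ k ≠ j} (t - 1) := by
  have key : lowDegOn F ι t ≤
      (lowDegOn F {k : ι // k ≠ i ∧ k ≠ j} (t - 1)).comap (descendLinear (F := F) i j) := by
    refine Submodule.span_le.2 ?_
    rintro _ ⟨⟨S, hS⟩, rfl⟩
    simp only [SetLike.mem_coe, Submodule.mem_comap, descendLinear_apply, descend_monoOn hij]
    by_cases hi : i ∈ S <;> by_cases hj : j ∈ S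
    · simp only [hi, hj, if_true, sub_self, Submodule.zero_mem]
    · simp only [hi, hj, if_true, if_false, sub_zero]
      exact monoOn_mem_lowDegOn
        (by rw [card_subtype_ne_of_mem_of_notMem hi hj]; exact Nat.sub_le_sub_right hS 1)
    · simp only [hi, hj, if_true, if_false, zero_sub]
      exact Submodule.neg_mem _ (monoOn_mem_lowDegOn
        (by rw [card_subtype_ne_of_notMem_of_mem hi hj]; exact Nat.sub_le_sub_right hS 1))
    · simp only [hi, hj, if_false, sub_self, Submodule.zero_mem]
  exact key hg

/-- The descent recovers `g(x) - g((i j)·x)` at points with `x_i = 1`, `x_j = 0`.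
[cite: BeckLi2013, §4, Lemma 4.1 (proof: `g - π(g) = (x_i - x_j) h`)] -/
theorem descend_restrict {i j : ι} (hij : i ≠ j) (g : (ι → Bool) → F) {x : ι → Bool}
    (hi : x i = true) (hj : x j = false) :
    descend i j g (fun k : {k : ι // k ≠ i ∧ k ≠ j} => x k) = g x - g (x ∘ Equiv.swap i j) := by
  have h1 : pairExt i j true false (fun k : {k : ι // k ≠ i ∧ k ≠ j} => x k) = x := by
    funext k
    unfold pairExt
    split_ifs with h1 h2
    · subst h1; exact hi.symm
    · subst h2; exact hj.symm
    · rfl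
  have h2 : pairExt i j false true (fun k : {k : ι // k ≠ i ∧ k ≠ j} => x k) =
      x ∘ Equiv.swap i j := by
    funext k
    unfold pairExt
    simp only [Function.comp]
    split_ifs with h1 h2
    · subst h1; rw [Equiv.swap_apply_left]; exact hj.symm
    · subst h2; rw [Equiv.swap_apply_right]; exact hi.symm
    · rw [Equiv.swap_apply_of_ne_of_ne h1 h2]
  simp only [descend, h1, h2]

omit [Field F] in
/-- The weight of an extended point. [cite: BeckLi2013, §5 (truth table of `f|_{ρ_i}`: the
weights shift by the number of variables set to `1`)] -/
theorem hwt_pairExt [Fintype ι] {i j : ι} (hij : i ≠ j) (bi bj : Bool)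
    (y : {k : ι // k ≠ i ∧ k ≠ j} → Bool) :
    hwt (pairExt i j bi bj y) =
      (if bi = true then 1 else 0) + (if bj = true then 1 else 0) + hwt y := by
  unfold hwt
  rw [Finset.card_filter, Finset.card_filter,
    ← Finset.sum_filter_add_sum_filter_not univ (fun k => k ≠ i ∧ k ≠ j)]
  have h1 : (univ.filter fun k => ¬(k ≠ i ∧ k ≠ j)) = {i, j} := by
    ext k
    simp only [mem_filter, mem_univ, true_and, mem_insert, mem_singleton, not_and_or, not_not]
  have h2 : ∑ k ∈ univ.filter (fun k => k ≠ i ∧ k ≠ j),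
      (if pairExt i j bi bj y k = true then 1 else 0) =
        ∑ k : {k : ι // k ≠ i ∧ k ≠ j}, (if y k = true then 1 else 0) := by
    rw [Finset.sum_subtype (univ.filter fun k => k ≠ i ∧ k ≠ j) (p := fun k => k ≠ i ∧ k ≠ j)
      (fun k => by simp)]
    exact Finset.sum_congr rfl fun k _ => by rw [pairExt_apply_coe]
  rw [h1, Finset.sum_pair hij, pairExt_apply_left, pairExt_apply_right hij, h2]
  ring

/-- **The descent preserves membership in the ideal**: if `g` vanishes at every point `x` with
`q ∣ |x| + s`, then `descend g` vanishes at every `y` with `q ∣ |y| + (s + 1)` (both extended points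
have weight `|y| + 1`). [cite: BeckLi2013, §4, Corollary 4.2 (`g' ∈ ⟨f|_ρ⟩`) and §5 (truth table
of `f|_{ρ_i}`)] -/
theorem descend_eq_zero_of_dvd [Fintype ι] {i j : ι} (hij : i ≠ j) {q s : ℕ}
    {g : (ι → Bool) → F} (hg : ∀ x, q ∣ hwt x + s → g x = 0)
    (y : {k : ι // k ≠ i ∧ k ≠ j} → Bool) (hy : q ∣ hwt y + (s + 1)) : descend i j g y = 0 := by
  have e1 : hwt (pairExt i j true false y) + s = hwt y + (s + 1) := by
    have := hwt_pairExt hij true false y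
    simp at this
    omega
  have e2 : hwt (pairExt i j false true y) + s = hwt y + (s + 1) := by
    have := hwt_pairExt hij false true y
    simp at this
    omega
  simp only [descend]
  rw [hg _ (e1 ▸ hy), hg _ (e2 ▸ hy), sub_self]

/-- `|ι ∖ {i, j}| = |ι| - 2`. [cite: BeckLi2013, §4, Corollary 4.2 (`n - 2ℓ` free variables)] -/
theorem card_subtype_ne_ne [Fintype ι] {i j : ι} (hij : i ≠ j) :
    Fintype.card {k : ι // k ≠ i ∧ k ≠ j} = Fintype.card ι - 2 := by
  rw [Fintype.card_subtype]
  have : (univ.filter fun k : ι => k ≠ i ∧ k ≠ j) = univ \ {i, j} := by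
    ext k
    simp only [mem_filter, mem_univ, true_and, mem_sdiff, mem_insert, mem_singleton, not_or]
  rw [this, Finset.card_sdiff_of_subset (Finset.subset_univ _), Finset.card_univ,
    Finset.card_pair hij]

/-! ### §3 Möbius inversion on the cube and the binomial representation of symmetric functions -/

/-- The Möbius coefficient `c_S(g) = Σ_{T ⊆ S} (-1)^{|S∖T|} g(1_T)` — the coefficient of the
monomial `x_S` in the multilinear polynomial representing `g`.
[cite: JuknaBFC2012, §2.1 (eq. (2.1), Möbius inversion)] -/
def mcoeff (S : Finset ι) (g : (ι → Bool) → F) : F :=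
  ∑ T ∈ S.powerset, (-1 : F) ^ (S.card - T.card) * g (indVec T)

/-- The Möbius coefficient is `F`-linear in `g`. [cite: JuknaBFC2012, §2.1 (eq. (2.1))] -/
def mcoeffLinear (S : Finset ι) : ((ι → Bool) → F) →ₗ[F] F where
  toFun := mcoeff S
  map_add' g h := by
    simp only [mcoeff, Pi.add_apply, mul_add, Finset.sum_add_distrib]
  map_smul' r g := by
    simp only [mcoeff, Pi.smul_apply, smul_eq_mul, RingHom.id_apply, Finset.mul_sum]
    exact Finset.sum_congr rfl fun _ _ => by ring

/-- Unfolding `mcoeffLinear`. [cite: JuknaBFC2012, §2.1 (eq. (2.1))] -/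
theorem mcoeffLinear_apply (S : Finset ι) (g : (ι → Bool) → F) :
    mcoeffLinear (F := F) S g = mcoeff S g := rfl

omit [Field F] in
/-- `1_{T ∪ {a}}` is `1_T` with the `a`-th coordinate set to `1`.
[cite: JuknaBFC2012, §2.1 (eq. (2.1))] -/
theorem indVec_insert (a : ι) (U : Finset ι) :
    indVec (insert a U) = Function.update (indVec U) a true := by
  funext k
  simp only [indVec, Function.update_apply, Finset.mem_insert]
  by_cases h : k = a <;> simp [h]

/-- Recursion of the Möbius coefficient in the set: `c_{S ∪ {a}}(g) = c_S(g(·; x_a = 1)) - c_S(g)`.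
[cite: JuknaBFC2012, §2.1 (eq. (2.1), Möbius inversion)] -/
theorem mcoeff_insert {a : ι} {S : Finset ι} (ha : a ∉ S) (g : (ι → Bool) → F) :
    mcoeff (insert a S) g = mcoeff S (fun x => g (Function.update x a true)) - mcoeff S g := by
  unfold mcoeff
  rw [Finset.sum_powerset_insert ha, Finset.card_insert_of_notMem ha]
  have h1 : ∑ T ∈ S.powerset, (-1 : F) ^ (S.card + 1 - T.card) * g (indVec T) =
      -∑ T ∈ S.powerset, (-1 : F) ^ (S.card - T.card) * g (indVec T) := by
    rw [← Finset.sum_neg_distrib]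
    refine Finset.sum_congr rfl fun T hT => ?_
    have hle : T.card ≤ S.card := Finset.card_le_card (Finset.mem_powerset.1 hT)
    rw [show S.card + 1 - T.card = (S.card - T.card) + 1 by omega, pow_succ]
    ring
  have h2 : ∑ T ∈ S.powerset,
      (-1 : F) ^ (S.card + 1 - (insert a T).card) * g (indVec (insert a T)) =
        ∑ T ∈ S.powerset, (-1 : F) ^ (S.card - T.card) * g (Function.update (indVec T) a true) := by
    refine Finset.sum_congr rfl fun T hT => ?_
    have haT : a ∉ T := fun h => ha (Finset.mem_powerset.1 hT h)
    rw [Finset.card_insert_of_notMem haT, Nat.add_sub_add_right, indVec_insert]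
  rw [h1, h2]
  ring

/-- **Möbius inversion on the cube**: `g(1_T) = Σ_{S ⊆ T} c_S(g)`, i.e. `g = Σ_S c_S(g) x_S`
evaluated at `1_T`. [cite: JuknaBFC2012, §2.1 (eq. (2.1), Möbius inversion)] -/
theorem moebius_inversion (g : (ι → Bool) → F) (T : Finset ι) :
    g (indVec T) = ∑ S ∈ T.powerset, mcoeff S g := by
  induction T using Finset.induction_on generalizing g with
  | empty => simp [mcoeff]
  | @insert a T ha ih =>
    rw [Finset.sum_powerset_insert ha]
    have h2 : ∑ S ∈ T.powerset, mcoeff (insert a S) g =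
        ∑ S ∈ T.powerset, (mcoeff S (fun x => g (Function.update x a true)) - mcoeff S g) :=
      Finset.sum_congr rfl fun S hS =>
        mcoeff_insert (fun haS => ha (Finset.mem_powerset.1 hS haS)) g
    rw [h2, Finset.sum_sub_distrib, ← ih g, ← ih (fun x => g (Function.update x a true)),
      indVec_insert]
    ring

/-- `c_S(x_{S'}) = 0` unless `S' ⊆ S`. [cite: JuknaBFC2012, §2.1 (eq. (2.1))] -/
theorem mcoeff_monoOn_of_not_subset {S S' : Finset ι} (h : ¬S' ⊆ S) :
    mcoeff S (monoOn F S') = 0 := by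
  unfold mcoeff
  refine Finset.sum_eq_zero fun T hT => ?_
  rw [monoOn_indVec, if_neg fun h' => h (h'.trans (Finset.mem_powerset.1 hT)), mul_zero]

/-- Setting `x_a = 1` in `x_{S'}` gives `x_{S' ∖ {a}}`. [cite: JuknaBFC2012, §2.1] -/
theorem monoOn_update_true (S' : Finset ι) (a : ι) (x : ι → Bool) :
    monoOn F S' (Function.update x a true) = monoOn F (S'.erase a) x := by
  rw [monoOn_apply, monoOn_apply]
  have hiff : (∀ i ∈ S', Function.update x a true i = true) ↔ ∀ i ∈ S'.erase a, x i = true := by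
    constructor
    · intro h i hi
      rw [Finset.mem_erase] at hi
      have := h i hi.2
      rwa [Function.update_of_ne hi.1] at this
    · intro h i hi
      by_cases hia : i = a
      · subst hia; rw [Function.update_self]
      · rw [Function.update_of_ne hia]; exact h i (Finset.mem_erase.2 ⟨hia, hi⟩)
  by_cases hA : ∀ i ∈ S', Function.update x a true i = true
  · rw [if_pos hA, if_pos (hiff.1 hA)]
  · rw [if_neg hA, if_neg fun h => hA (hiff.2 h)]

/-- `c_S(x_{S'}) = 0` whenever `|S'| < |S|`. [cite: JuknaBFC2012, §2.1 (eq. (2.1): the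
coefficient of `x_S` in a polynomial of degree `< |S|` vanishes)] -/
theorem mcoeff_monoOn_eq_zero_of_card_lt :
    ∀ S S' : Finset ι, S'.card < S.card → mcoeff S (monoOn F S') = 0 := by
  intro S
  induction S using Finset.induction_on with
  | empty => intro S' h; simp at h
  | @insert a S ha ih =>
    intro S' hlt
    rw [mcoeff_insert ha]
    have e : (fun x => monoOn F S' (Function.update x a true)) = monoOn F (S'.erase a) := by
      funext x; exact monoOn_update_true S' a x
    rw [e]
    by_cases haS' : a ∈ S'
    · rw [Finset.card_insert_of_notMem ha] at hlt
      have hpos := Finset.card_pos.2 ⟨a, haS'⟩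
      rw [ih (S'.erase a) (by rw [Finset.card_erase_of_mem haS']; omega),
        mcoeff_monoOn_of_not_subset fun h => ha (h haS'), sub_zero]
    · rw [Finset.erase_eq_of_notMem haS', sub_self]

/-- **The Möbius coefficients of a function of degree `≤ t` vanish above `t`.**
[cite: JuknaBFC2012, §2.1 (eq. (2.1), Möbius inversion: uniqueness of the multilinear
representation)] -/
theorem mcoeff_eq_zero_of_mem_lowDegOn {t : ℕ} {g : (ι → Bool) → F} (hg : g ∈ lowDegOn F ι t)
    {S : Finset ι} (hS : t < S.card) : mcoeff S g = 0 := by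
  have key : lowDegOn F ι t ≤ LinearMap.ker (mcoeffLinear (F := F) S) := by
    refine Submodule.span_le.2 ?_
    rintro _ ⟨⟨S', hS'⟩, rfl⟩
    simp only [SetLike.mem_coe, LinearMap.mem_ker, mcoeffLinear_apply]
    exact mcoeff_monoOn_eq_zero_of_card_lt S S' (by omega)
  exact key hg

/-- **Binomial representation of symmetric low-degree functions**: a function of degree `≤ t`
depending only on `|x|` is `x ↦ Σ_{k ≤ t} C_k · binom(|x|, k)` (`g = Σ_{i<d} c_i σ_i` with `σ_i`
the elementary symmetric polynomials, `σ_i(x) = binom(|x|, i)`).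
[cite: BeckLi2013, §5 (before Lemma 5.1: `g = Σ_{i<d} c_i σ_i`, `ψ_d(i) = (binom(i,0), …,
binom(i,d-1))` "is the evaluation of σ_0, …, σ_{d-1} at value i")] -/
theorem exists_binomial_rep [Fintype ι] {t : ℕ} {g : (ι → Bool) → F} (hg : g ∈ lowDegOn F ι t)
    (hsym : ∀ x x' : ι → Bool, hwt x = hwt x' → g x = g x') :
    ∃ c : ℕ → F, ∀ x, g x = ∑ k ∈ range (t + 1), ((hwt x).choose k : F) * c k := by
  classical
  have hv : ∃ v : ℕ → F, ∀ x, g x = v (hwt x) := by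
    refine ⟨fun w => if h : ∃ x : ι → Bool, hwt x = w then g h.choose else 0, fun x => ?_⟩
    have h : ∃ x' : ι → Bool, hwt x' = hwt x := ⟨x, rfl⟩
    simp only [dif_pos h]
    exact hsym _ _ h.choose_spec.symm
  obtain ⟨v, hv⟩ := hv
  let C : ℕ → F := fun k => ∑ m ∈ range (k + 1), (k.choose m : F) * ((-1) ^ (k - m) * v m)
  have hC : ∀ S : Finset ι, mcoeff S g = C S.card := by
    intro S
    simp only [mcoeff, hv, hwt_indVec]
    have e := Finset.sum_powerset_apply_card (fun m => (-1 : F) ^ (S.card - m) * v m) (x := S)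
    simp only [nsmul_eq_mul] at e
    exact e
  refine ⟨C, fun x => ?_⟩
  have hx : g x = ∑ S ∈ (univ.filter fun i => x i = true).powerset, mcoeff S g := by
    rw [← moebius_inversion g, indVec_support]
  rw [hx]
  simp only [hC]
  have e := Finset.sum_powerset_apply_card (fun m => C m) (x := univ.filter fun i => x i = true)
  simp only [nsmul_eq_mul] at e
  rw [e]
  change ∑ m ∈ range (hwt x + 1), ((hwt x).choose m : F) * C m = _
  have hCz : ∀ k, t < k → k ≤ hwt x → C k = 0 := by
    intro k hk hkx
    obtain ⟨S, -, hcard⟩ := Finset.exists_subset_card_eq (s := univ.filter fun i => x i = true)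
      (n := k) hkx
    rw [← hcard, ← hC S]
    exact mcoeff_eq_zero_of_mem_lowDegOn hg (hcard ▸ hk)
  have hsub : ∀ A B : ℕ, A ≤ B → (∀ k, A < k → k ≤ B → ((hwt x).choose k : F) * C k = 0) →
      ∑ k ∈ range (A + 1), ((hwt x).choose k : F) * C k =
        ∑ k ∈ range (B + 1), ((hwt x).choose k : F) * C k := by
    intro A B hAB hz
    refine Finset.sum_subset (Finset.range_subset_range.2 (Nat.succ_le_succ hAB)) fun k hk hk' => ?_
    have h1 := mem_range.1 hk
    have h2 : ¬k < A + 1 := fun h' => hk' (mem_range.2 h')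
    exact hz k (by omega) (by omega)
  rcases le_total (hwt x) t with h | h
  · exact hsub _ _ h fun k hk _ => by rw [Nat.choose_eq_zero_of_lt hk, Nat.cast_zero, zero_mul]
  · exact (hsub _ _ h fun k hk hk' => by rw [hCz k hk hk', mul_zero]).symm

/-! ### §4 Beck–Li's Lemma 5.1: the binomial vectors `ψ(a), ψ(a+q), …, ψ(a+tq)` are a basis -/

/-- **Beck–Li 2013, Lemma 5.1** (in the form used): over a field in which `q` is invertible, a
combination `w ↦ Σ_{k ≤ t} c_k binom(w, k)` vanishing at the `t + 1` points `a, a+q, …, a+tq` of an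
arithmetic progression with difference `q` is trivial ("the vectors `ψ_d(a), ψ_d(a+q), …,
ψ_d(a+(d-1)q) ∈ F_p^d` form a basis", `d = t + 1`; printed proof: the determinant is
`q^{d(d-1)/2}`; here: in `F[X]`, `Σ_k c_k·coeff_k` kills `(X+1)^a ((X+1)^q - 1)^k = X^k · unit`
for `k ≤ t`, and `(X+1)^q - 1 = X·(q + …)`). [cite: BeckLi2013, §5, Lemma 5.1] -/
theorem beckLi2013_lemma51 {q : ℕ} (hq : (q : F) ≠ 0) (t a : ℕ) (c : ℕ → F)
    (h : ∀ j ≤ t, ∑ k ∈ range (t + 1), (((a + j * q).choose k : ℕ) : F) * c k = 0) :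
    ∀ k ≤ t, c k = 0 := by
  -- the functional `φ(P) = Σ_{k ≤ t} c_k · coeff_k(P)` on `F[X]`
  let φ : F[X] →ₗ[F] F := ∑ k ∈ range (t + 1), c k • Polynomial.lcoeff F k
  have hφ : ∀ P : F[X], φ P = ∑ k ∈ range (t + 1), c k * P.coeff k := by
    intro P
    simp only [φ, LinearMap.sum_apply, LinearMap.smul_apply, Polynomial.lcoeff_apply, smul_eq_mul]
  set u : F[X] := (X + 1) ^ q with hu
  -- `φ((X+1)^a u^j) = 0` for `j ≤ t`
  have h0 : ∀ j ≤ t, φ ((X + 1) ^ a * u ^ j) = 0 := by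
    intro j hj
    rw [hφ, hu, ← pow_mul, ← pow_add]
    simp only [Polynomial.coeff_X_add_one_pow]
    rw [← h j hj]
    exact Finset.sum_congr rfl fun k _ => by rw [Nat.mul_comm q j]; exact mul_comm _ _
  -- `φ((X+1)^a (u-1)^k) = 0` for `k ≤ t`
  have h1 : ∀ k ≤ t, φ ((X + 1) ^ a * (u - 1) ^ k) = 0 := by
    intro k hk
    rw [sub_eq_add_neg, add_pow u (-1 : F[X]) k, Finset.mul_sum, map_sum]
    refine Finset.sum_eq_zero fun m hm => ?_
    have hm' : m ≤ k := Nat.lt_succ_iff.1 (mem_range.1 hm)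
    have e : (X + 1 : F[X]) ^ a * (u ^ m * (-1) ^ (k - m) * ((k.choose m : ℕ) : F[X])) =
        Polynomial.C ((-1) ^ (k - m) * (k.choose m : F)) * ((X + 1) ^ a * u ^ m) := by
      simp only [map_mul, map_pow, map_neg, map_one, map_natCast]
      ring
    rw [e, Polynomial.C_mul', map_smul, h0 m (hm'.trans hk), smul_zero]
  -- `u - 1 = X * v` with `v(0) = q`
  set v : F[X] := Polynomial.divX (u - 1) with hv
  have huv : u - 1 = X * v := by
    have e := Polynomial.divX_mul_X_add (u - 1)
    have h00 : (u - 1).coeff 0 = 0 := by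
      rw [hu, Polynomial.coeff_sub, Polynomial.coeff_X_add_one_pow, Nat.choose_zero_right,
        Nat.cast_one, Polynomial.coeff_one_zero, sub_self]
    rw [h00, map_zero, add_zero] at e
    rw [← e, mul_comm]
  have hv0 : v.coeff 0 = q := by
    rw [hv, Polynomial.coeff_divX, zero_add, hu, Polynomial.coeff_sub,
      Polynomial.coeff_X_add_one_pow, Nat.choose_one_right, Polynomial.coeff_one]
    simp
  have hvk : ∀ k : ℕ, (v ^ k).coeff 0 = (q : F) ^ k := by
    intro k
    induction k with
    | zero => simp
    | succ k ihk => rw [pow_succ, Polynomial.mul_coeff_zero, ihk, hv0, pow_succ]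
  have hW0 : ∀ k : ℕ, ((X + 1 : F[X]) ^ a * v ^ k).coeff 0 = (q : F) ^ k := by
    intro k
    rw [Polynomial.mul_coeff_zero, Polynomial.coeff_X_add_one_pow, Nat.choose_zero_right,
      Nat.cast_one, one_mul, hvk]
  -- `φ(X^k W) = c_k W(0)` once `c_{k'} = 0` for `k < k' ≤ t`
  have step : ∀ k ≤ t, (∀ k', k < k' → k' ≤ t → c k' = 0) → c k = 0 := by
    intro k hk ih
    have hP : φ (X ^ k * ((X + 1) ^ a * v ^ k)) = 0 := by
      have e : (X : F[X]) ^ k * ((X + 1) ^ a * v ^ k) = (X + 1) ^ a * (u - 1) ^ k := by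
        rw [huv]; ring
      rw [e]
      exact h1 k hk
    rw [hφ, Finset.sum_eq_single k] at hP
    · rw [Polynomial.coeff_X_pow_mul', if_pos le_rfl, Nat.sub_self, hW0] at hP
      rcases mul_eq_zero.1 hP with h' | h'
      · exact h'
      · exact absurd h' (pow_ne_zero k hq)
    · intro k' hk' hne
      rw [Polynomial.coeff_X_pow_mul']
      by_cases hkk : k ≤ k'
      · rw [ih k' (lt_of_le_of_ne hkk (Ne.symm hne)) (Nat.lt_succ_iff.1 (mem_range.1 hk')),
          zero_mul]
      · rw [if_neg hkk, mul_zero]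
    · intro hk'
      exact absurd (mem_range.2 (Nat.lt_succ_of_le hk)) hk'
  -- downward induction
  have main : ∀ d k, k ≤ t → t - k ≤ d → c k = 0 := by
    intro d
    induction d with
    | zero =>
      intro k hk hd
      exact step k hk fun k' h1 h2 => absurd h2 (by omega)
    | succ d ihd =>
      intro k hk hd
      exact step k hk fun k' h1 h2 => ihd k' h2 (by omega)
  intro k hk
  exact main (t - k) k hk le_rfl

/-! ### §5 The layered vanishing theorem and Beck–Li's Theorem 5.2 (lower bound) -/

/-- **The symmetrisation argument, general form.** Let `q` be invertible in the field `F` and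
`s ∈ ℕ` a shift. Suppose that for every `ℓ ≤ t` the weights `w ∈ [ℓ, |ι| - ℓ]` with `q ∣ w + s`
contain an arithmetic progression `a, a + q, …, a + (t - ℓ)q`. Then a function `g` on `{0,1}^ι` of
degree `≤ t` vanishing at every point `x` with `q ∣ |x| + s` is zero. (Beck–Li's proof of Theorem
5.2: by Lemma 4.1 / Corollary 4.2 descend along transpositions `(i j)` — each descent lowers the
degree by one, removes two variables and shifts the weights by one — until the function is
symmetric, then apply Lemma 5.1 to its binomial representation.)
[cite: BeckLi2013, §4 Lemma 4.1, Corollary 4.2 and §5 proof of Theorem 5.2] -/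
theorem eq_zero_of_lowDegOn_of_forall_dvd_hwt {q : ℕ} (hqF : (q : F) ≠ 0) :
    ∀ (t : ℕ) {κ : Type*} [Fintype κ] [DecidableEq κ] (s : ℕ),
      (∀ ℓ ≤ t, ∃ a, q ∣ a + s ∧ ℓ ≤ a ∧ a + (t - ℓ) * q + ℓ ≤ Fintype.card κ) →
      ∀ g ∈ lowDegOn F κ t, (∀ x, q ∣ hwt x + s → g x = 0) → g = 0 := by
  intro t
  induction t with
  | zero =>
    intro κ _ _ s hH g hg hvan
    obtain ⟨a, hqa, -, ha⟩ := hH 0 le_rfl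
    have hle : lowDegOn F κ 0 ≤ Submodule.span F {fun _ : κ → Bool => (1 : F)} := by
      refine Submodule.span_le.2 ?_
      rintro _ ⟨⟨S, hS⟩, rfl⟩
      have hS0 : S = ∅ := Finset.card_eq_zero.1 (Nat.le_zero.1 hS)
      subst hS0
      refine Submodule.subset_span ?_
      rw [Set.mem_singleton_iff]
      funext b
      simp [monoOn]
    obtain ⟨r, hr⟩ := Submodule.mem_span_singleton.1 (hle hg)
    obtain ⟨S, -, hS⟩ := Finset.exists_subset_card_eq (s := (univ : Finset κ)) (n := a)
      (by rw [Finset.card_univ]; simpa using ha)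
    have h0 := hvan (indVec S) (by rw [hwt_indVec, hS]; exact hqa)
    rw [← hr] at h0 ⊢
    simp only [Pi.smul_apply, smul_eq_mul, mul_one] at h0
    rw [h0, zero_smul]
  | succ t ih =>
    intro κ _ _ s hH g hg hvan
    by_contra hne
    by_cases hsym : ∀ i j : κ, i ≠ j → ∀ x : κ → Bool, x i = true → x j = false →
        g (x ∘ Equiv.swap i j) = g x
    · -- symmetric case: binomial representation + Lemma 5.1
      obtain ⟨c, hc⟩ := exists_binomial_rep hg (eq_of_hwt_eq_of_swap_invariant hsym)
      obtain ⟨a, hqa, -, ha⟩ := hH 0 (Nat.zero_le _)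
      have hck : ∀ k ≤ t + 1, c k = 0 := by
        refine beckLi2013_lemma51 hqF (t + 1) a c fun j hj => ?_
        have hjq : j * q ≤ (t + 1 - 0) * q := Nat.mul_le_mul_right _ (by omega)
        obtain ⟨S, -, hS⟩ := Finset.exists_subset_card_eq (s := (univ : Finset κ))
          (n := a + j * q) (by rw [Finset.card_univ]; omega)
        have hx := hvan (indVec S) (by
          rw [hwt_indVec, hS, add_assoc, add_comm (j * q), ← add_assoc]
          exact (Nat.dvd_add_right hqa).2 (dvd_mul_left q j))
        rwa [hc, hwt_indVec, hS] at hx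
      apply hne
      funext x
      rw [hc, Pi.zero_apply]
      exact Finset.sum_eq_zero fun k hk => by
        rw [hck k (Nat.lt_succ_iff.1 (mem_range.1 hk)), mul_zero]
    · -- descent along a transposition
      push Not at hsym
      obtain ⟨i, j, hij, x, hi, hj, hx⟩ := hsym
      have h1 : descend i j g ∈ lowDegOn F {k : κ // k ≠ i ∧ k ≠ j} t := by
        simpa using descend_mem_lowDegOn hij hg
      have h2 : ∀ y, q ∣ hwt y + (s + 1) → descend i j g y = 0 :=
        fun y hy => descend_eq_zero_of_dvd hij hvan y hy
      have h3 : descend i j g ≠ 0 := by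
        intro h0
        have := congrFun h0 (fun k : {k : κ // k ≠ i ∧ k ≠ j} => x k)
        rw [descend_restrict hij g hi hj, Pi.zero_apply, sub_eq_zero] at this
        exact hx this.symm
      have hcard := card_subtype_ne_ne hij
      refine h3 (ih (s + 1) (fun ℓ hℓ => ?_) (descend i j g) h1 h2)
      obtain ⟨a, hqa, hℓa, ha⟩ := hH (ℓ + 1) (by omega)
      refine ⟨a - 1, ?_, by omega, ?_⟩
      · rwa [show a - 1 + (s + 1) = a + s by omega]
      · rw [hcard]
        rw [show t + 1 - (ℓ + 1) = t - ℓ by omega] at ha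
        omega

/-- **Beck–Li 2013, Theorem 5.2 (lower bound), over any field in which `q` is invertible.**
If `q ≥ 2`, `q·t < n` (i.e. `t < ⌈n/q⌉ = ⌊(n+q-1)/q⌋`) and `f : {0,1}ⁿ → F` has degree `≤ t` and
vanishes at every point `x` with `q ∣ |x|` — i.e. `f` lies in the ideal `⟨¬χ_q⟩` — then `f = 0`.
[cite: BeckLi2013, Theorem 5.2 (proof: Corollary 4.2 + Lemma 5.1; the arithmetic
`min{⌊n/q⌋ + 1, ⌊(n-i)/q⌋ - ⌊(i-1)/q⌋ + i} = ⌊(n+q-1)/q⌋`)] -/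
theorem eq_zero_of_lowDeg_of_forall_dvd_card {q : ℕ} (hqF : (q : F) ≠ 0) (hq : 1 < q) {n t : ℕ}
    (ht : q * t < n) {f : CubeFn F n} (hf : f ∈ lowDeg F n t)
    (hvan : ∀ b, q ∣ (univ.filter fun i => b i = true).card → f b = 0) : f = 0 := by
  rw [lowDeg_eq_lowDegOn] at hf
  refine eq_zero_of_lowDegOn_of_forall_dvd_hwt hqF t 0 (fun ℓ hℓ => ?_) f hf
    (fun x hx => hvan x (by simpa [hwt] using hx))
  rw [Fintype.card_fin]
  have ht' : t * q < n := by rwa [Nat.mul_comm] at ht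
  rcases Nat.eq_zero_or_pos ℓ with rfl | hℓpos
  · exact ⟨0, by simp, le_rfl, by simpa using ht'.le⟩
  · refine ⟨q * ((ℓ + q - 1) / q), by simp, ?_, ?_⟩
    · have h1 := Nat.div_add_mod (ℓ + q - 1) q
      have h2 := Nat.mod_lt (ℓ + q - 1) (by omega : q > 0)
      omega
    · have hA : q * ((ℓ + q - 1) / q) ≤ ℓ + q - 1 := Nat.mul_div_le _ _
      have key : (t - ℓ) * q + ℓ * q = t * q := by
        rw [← Nat.add_mul, Nat.sub_add_cancel hℓ]
      have hprod : (ℓ - 1) * (q - 2) + 2 * ℓ + q = ℓ * q + 2 := by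
        obtain ⟨ℓ', rfl⟩ : ∃ ℓ', ℓ = ℓ' + 1 := ⟨ℓ - 1, by omega⟩
        obtain ⟨q', rfl⟩ : ∃ q', q = q' + 2 := ⟨q - 2, by omega⟩
        simp only [Nat.add_sub_cancel]
        ring
      omega

/-- **Beck–Li 2013, Theorem 5.2 (the immunity of `¬MOD_q` over `𝔽_p` is `⌊(n+q-1)/q⌋`; lower
bound, as printed).** Let `p` be a prime and `q ≥ 2` an integer coprime to `p`. Every
`f : {0,1}ⁿ → 𝔽_p` of degree `t < ⌊(n+q-1)/q⌋` in the ideal `⟨¬χ_q⟩` of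
`𝔽_p[x₁,…,xₙ]/(xᵢ² = xᵢ)` — i.e. vanishing at every `x` with `|x| ≡ 0 (mod q)` — is zero: no
non-zero element of `⟨¬χ_q⟩` has degree `< ⌊(n+q-1)/q⌋`. (The matching upper bound — a non-zero
element of degree `⌊(n+q-1)/q⌋` — is `beckLi2013_thm52_attained` below.)
[cite: BeckLi2013, Theorem 5.2] -/
theorem beckLi2013_thm52 {p : ℕ} [Fact p.Prime] {q : ℕ} (hq : 1 < q) (hpq : ¬p ∣ q) {n t : ℕ}
    (ht : t < (n + q - 1) / q) {f : CubeFn (ZMod p) n} (hf : f ∈ lowDeg (ZMod p) n t)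
    (hvan : ∀ b, q ∣ (univ.filter fun i => b i = true).card → f b = 0) : f = 0 := by
  have hqF : (q : ZMod p) ≠ 0 := fun h => hpq ((ZMod.natCast_eq_zero_iff q p).1 h)
  have h1 : (t + 1) * q ≤ n + q - 1 := (Nat.le_div_iff_mul_le (by omega)).1 ht
  have ht' : q * t < n := by
    rw [Nat.add_mul, one_mul] at h1
    rw [Nat.mul_comm]
    omega
  exact eq_zero_of_lowDeg_of_forall_dvd_card hqF hq ht' hf hvan

/-- **Beck–Li 2013, Theorem 5.2 (lower bound) with the degree hypothesis spelled `q·t < n`.**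
[cite: BeckLi2013, Theorem 5.2] -/
theorem beckLi2013_thm52' {p : ℕ} [Fact p.Prime] {q : ℕ} (hq : 1 < q) (hpq : ¬p ∣ q) {n t : ℕ}
    (ht : q * t < n) {f : CubeFn (ZMod p) n} (hf : f ∈ lowDeg (ZMod p) n t)
    (hvan : ∀ b, q ∣ (univ.filter fun i => b i = true).card → f b = 0) : f = 0 :=
  eq_zero_of_lowDeg_of_forall_dvd_card
    (fun h => hpq ((ZMod.natCast_eq_zero_iff q p).1 h)) hq ht hf hvan

/-! ### §6 Theorem 5.2, upper bound: a non-zero element of `⟨¬χ_q⟩` of degree `⌊(n+q-1)/q⌋` -/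

omit [Field F] in
/-- A point of the cube is the extension of its restriction. [cite: BeckLi2013, §4, Corollary 4.2
(the restrictions `ρ`)] -/
theorem pairExt_restrict (i j : ι) (x : ι → Bool) :
    pairExt i j (x i) (x j) (fun k : {k : ι // k ≠ i ∧ k ≠ j} => x k) = x := by
  funext k
  unfold pairExt
  split_ifs with h1 h2
  · subst h1; rfl
  · subst h2; rfl
  · rfl

omit [Field F] in
/-- Restricting an extended point recovers the point. [cite: BeckLi2013, §4, Corollary 4.2] -/
theorem restrict_pairExt (i j : ι) (bi bj : Bool) (y : {k : ι // k ≠ i ∧ k ≠ j} → Bool) :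
    (fun k : {k : ι // k ≠ i ∧ k ≠ j} => pairExt i j bi bj y k) = y := by
  funext k
  exact pairExt_apply_coe i j bi bj y k

omit [Field F] in
/-- The weight of the restriction of `b` to the variables `≠ i, j` is the number of coordinates
`k ≠ i, j` with `b_k = 1`. [cite: BeckLi2013, §5 (truth table of `f|_{ρ_i}`)] -/
theorem hwt_restrict_eq [Fintype ι] (i j : ι) (b : ι → Bool) :
    hwt (fun k : {k : ι // k ≠ i ∧ k ≠ j} => b k) =
      ((univ.filter fun k : ι => k ≠ i ∧ k ≠ j).filter fun k => b k = true).card := by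
  unfold hwt
  have e : (univ.filter fun k : {k : ι // k ≠ i ∧ k ≠ j} => b k = true) =
      (univ.filter fun k : ι => b k = true).subtype (fun k => k ≠ i ∧ k ≠ j) := by
    ext k
    simp [Finset.mem_subtype]
  rw [e, Finset.card_subtype]
  congr 1
  ext k
  simp only [mem_filter, mem_univ, true_and]
  tauto

omit [DecidableEq ι] in
/-- The symmetric layer sums: `Σ_{S ⊆ A, |S| = k} x_S (b) = binom(#{i ∈ A : b_i = 1}, k)` — the
elementary symmetric polynomial `σ_k` in the variables `A` takes the value `binom(w, k)` at a
point of weight `w` ("`ψ_d(i)` … is the evaluation `σ_0, σ_1, …, σ_{d-1}` at value `i`").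
[cite: BeckLi2013, §5 (before Lemma 5.1)] -/
theorem sum_powersetCard_monoOn (A : Finset ι) (k : ℕ) (b : ι → Bool) :
    ∑ S ∈ A.powersetCard k, monoOn F S b =
      (((A.filter fun i => b i = true).card.choose k : ℕ) : F) := by
  simp_rw [monoOn_apply]
  rw [Finset.sum_boole]
  congr 1
  rw [← Finset.card_powersetCard]
  congr 1
  ext S
  simp only [mem_filter, mem_powersetCard]
  constructor
  · rintro ⟨⟨hSA, hcard⟩, hb⟩
    exact ⟨fun x hx => Finset.mem_filter.2 ⟨hSA hx, hb x hx⟩, hcard⟩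
  · rintro ⟨h, hcard⟩
    exact ⟨⟨fun x hx => (Finset.mem_filter.1 (h hx)).1, hcard⟩,
      fun x hx => (Finset.mem_filter.1 (h hx)).2⟩

/-- **Beck–Li 2013, Theorem 5.2, upper bound (the construction), `n ≥ 2` variables, any field.**
For `q ≥ 2` there is a non-zero `f : {0,1}^{m+2} → F` of degree `≤ ⌊(m+1)/q⌋ + 1`
(`= ⌊(n+q-1)/q⌋` for `n = m + 2`) vanishing at every `x` with `q ∣ |x|`: following the printed
proof ("the minimal degree of nonzero symmetric function in `⟨¬χ_q|_{ρ_1}⟩` is … `⌊(n-1)/q⌋`",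
Corollary 4.2 with `ℓ = 1`), `f = (x₁ - x₂) · Σ_{k ≤ d} c_k σ_k(x₃, …, xₙ)` with `d = ⌊(n-1)/q⌋`
and `c ≠ 0` solving the `d` linear conditions `Σ_k c_k binom(w, k) = 0` for the `d` weights
`w ∈ [0, n-2]` with `q ∣ w + 1` (`d + 1` unknowns); `f ≠ 0` by Lemma 5.1 with difference `1`.
[cite: BeckLi2013, Theorem 5.2 (proof) with Corollary 4.2 and Lemma 5.1] -/
theorem exists_ne_zero_mem_lowDeg_forall_dvd_card (q m : ℕ) (hq : 1 < q) :
    ∃ f : CubeFn F (m + 2), f ≠ 0 ∧ f ∈ lowDeg F (m + 2) ((m + 1) / q + 1) ∧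
      ∀ b, q ∣ (univ.filter fun i => b i = true).card → f b = 0 := by
  classical
  -- the two distinguished variables and the remaining ones
  set i0 : Fin (m + 2) := 0 with hi0
  set i1 : Fin (m + 2) := 1 with hi1
  have h01 : i0 ≠ i1 := by simp [hi0, hi1]
  set A : Finset (Fin (m + 2)) := univ.filter fun k => k ≠ i0 ∧ k ≠ i1 with hA
  set d : ℕ := (m + 1) / q with hd
  -- the constraint weights `w ∈ [0, m]` with `q ∣ w + 1`: there are `d` of them
  set W : Finset ℕ := (range (m + 1)).filter fun w => q ∣ w + 1 with hW
  have hWcard : W.card = d := Nat.card_multiples (m + 1) q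
  -- a non-zero solution of the `d` homogeneous conditions in `d + 1` unknowns
  let L : (Fin (d + 1) → F) →ₗ[F] (W → F) :=
    { toFun := fun c w => ∑ k : Fin (d + 1), (((w : ℕ).choose k : ℕ) : F) * c k
      map_add' := fun c c' => by
        funext w
        simp only [Pi.add_apply, mul_add, Finset.sum_add_distrib]
      map_smul' := fun r c => by
        funext w
        simp only [Pi.smul_apply, smul_eq_mul, RingHom.id_apply, Finset.mul_sum]
        exact Finset.sum_congr rfl fun _ _ => by ring }
  have hker : LinearMap.ker L ≠ ⊥ := by
    apply LinearMap.ker_ne_bot_of_finrank_lt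
    rw [Module.finrank_fintype_fun_eq_card, Module.finrank_fintype_fun_eq_card,
      Fintype.card_coe, hWcard, Fintype.card_fin]
    exact Nat.lt_succ_self d
  obtain ⟨c, hcL, hc0⟩ := Submodule.exists_mem_ne_zero_of_ne_bot hker
  rw [LinearMap.mem_ker] at hcL
  -- the coefficients as a sequence and the symmetric factor `P(w) = Σ_k binom(w,k) c_k`
  let c' : ℕ → F := fun k => if h : k < d + 1 then c ⟨k, h⟩ else 0
  let P : ℕ → F := fun w => ∑ k ∈ range (d + 1), ((w.choose k : ℕ) : F) * c' k
  have hPL : ∀ w : W, P w = L c w := by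
    intro w
    simp only [P, c']
    rw [Finset.sum_range (fun k => (((w : ℕ).choose k : ℕ) : F) * c' k)]
    exact Finset.sum_congr rfl fun k _ => by simp only [c']; rw [dif_pos k.2]
  have hPW : ∀ w, w < m + 1 → q ∣ w + 1 → P w = 0 := by
    intro w hw hqw
    have hmem : w ∈ W := by rw [hW]; exact Finset.mem_filter.2 ⟨mem_range.2 hw, hqw⟩
    rw [hPL ⟨w, hmem⟩, hcL]
    rfl
  -- the function
  let f : CubeFn F (m + 2) := fun b =>
    ((if b i0 = true then (1 : F) else 0) - (if b i1 = true then 1 else 0)) *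
      P (hwt (fun k : {k : Fin (m + 2) // k ≠ i0 ∧ k ≠ i1} => b k))
  refine ⟨f, ?_, ?_, ?_⟩
  · -- `f ≠ 0`: otherwise `P` vanishes at `0, 1, …, d` and Lemma 5.1 (difference `1`) kills `c`
    intro hf0
    have hdm : d ≤ m := by
      have : (m + 1) / q ≤ (m + 1) / 2 := Nat.div_le_div_left hq (by norm_num)
      omega
    have hP0 : ∀ j ≤ d, ∑ k ∈ range (d + 1), (((0 + j * 1).choose k : ℕ) : F) * c' k = 0 := by
      intro j hj
      obtain ⟨S, -, hS⟩ := Finset.exists_subset_card_eq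
        (s := (univ : Finset {k : Fin (m + 2) // k ≠ i0 ∧ k ≠ i1})) (n := j)
        (by rw [Finset.card_univ, card_subtype_ne_ne h01, Fintype.card_fin]; omega)
      have h := congrFun hf0 (pairExt i0 i1 true false (indVec S))
      simp only [f, Pi.zero_apply, pairExt_apply_left, pairExt_apply_right h01, restrict_pairExt,
        hwt_indVec, hS] at h
      simpa using h
    have hc' := beckLi2013_lemma51 (F := F) (q := 1) (by simp) d 0 c' hP0
    apply hc0
    funext k
    have := hc' k (Nat.lt_succ_iff.1 k.2)
    simp only [c'] at this
    rw [dif_pos k.2] at this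
    exact this
  · -- degree: `f = (x_{i0} - x_{i1}) · Σ_k c'_k Σ_{S ⊆ A, |S| = k} x_S`
    have hrepr : f = (mono F {i0} - mono F {i1}) *
        ∑ k ∈ range (d + 1), c' k • ∑ S ∈ A.powersetCard k, mono F S := by
      funext b
      simp only [f, Pi.mul_apply, Pi.sub_apply, Finset.sum_apply, Pi.smul_apply, smul_eq_mul]
      congr 1
      · simp [mono_apply]
      · refine Finset.sum_congr rfl fun k _ => ?_
        rw [show (∑ S ∈ A.powersetCard k, mono F S b) = ∑ S ∈ A.powersetCard k, monoOn F S b from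
          rfl, sum_powersetCard_monoOn, hwt_restrict_eq, mul_comm]
    rw [hrepr]
    have key : (mono F {i0} - mono F {i1}) *
        ∑ k ∈ range (d + 1), c' k • ∑ S ∈ A.powersetCard k, mono F S ∈
          lowDeg F (m + 2) (1 + d) := by
      refine mul_mem_lowDeg_add (Submodule.sub_mem _ (mono_mem_lowDeg (by simp))
        (mono_mem_lowDeg (by simp))) (Submodule.sum_mem _ fun k hk => Submodule.smul_mem _ _
          (Submodule.sum_mem _ fun S hS => mono_mem_lowDeg ?_))
      rw [(Finset.mem_powersetCard.1 hS).2]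
      exact Nat.lt_succ_iff.1 (mem_range.1 hk)
    exact lowDeg_mono (by omega) key
  · -- vanishing on `{x : q ∣ |x|}`
    intro b hb
    simp only [f]
    by_cases h01b : b i0 = b i1
    · rw [h01b, sub_self, zero_mul]
    · have e := hwt_pairExt h01 (b i0) (b i1) (fun k : {k : Fin (m + 2) // k ≠ i0 ∧ k ≠ i1} => b k)
      rw [pairExt_restrict] at e
      change q ∣ hwt b at hb
      have hle : hwt (fun k : {k : Fin (m + 2) // k ≠ i0 ∧ k ≠ i1} => b k) ≤ m := by
        have := Finset.card_filter_le (univ : Finset {k : Fin (m + 2) // k ≠ i0 ∧ k ≠ i1})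
          (fun k => b k = true)
        rw [Finset.card_univ, card_subtype_ne_ne h01, Fintype.card_fin] at this
        simpa [hwt] using this
      have h1 : hwt b = hwt (fun k : {k : Fin (m + 2) // k ≠ i0 ∧ k ≠ i1} => b k) + 1 := by
        rcases Bool.eq_false_or_eq_true (b i0) with h0 | h0 <;>
          rcases Bool.eq_false_or_eq_true (b i1) with h1' | h1' <;>
            simp [h0, h1'] at e h01b ⊢ <;> omega
      rw [hPW _ (by omega) (by rw [h1] at hb; exact hb), mul_zero]

/-- **Beck–Li 2013, Theorem 5.2, upper bound (attainment), any field.** For `q ≥ 2` and `n ≥ 1`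
there is a non-zero `f : {0,1}ⁿ → F` of degree `≤ ⌊(n+q-1)/q⌋` in the ideal `⟨¬χ_q⟩`, i.e.
vanishing at every `x` with `q ∣ |x|`; together with `eq_zero_of_lowDeg_of_forall_dvd_card` /
`beckLi2013_thm52` this is the printed equality "the immunity of `¬χ_q` over `F_p` is
`⌊(n+q-1)/q⌋`" (for `n = 1`: `f = x₁`). [cite: BeckLi2013, Theorem 5.2] -/
theorem beckLi2013_thm52_attained {q n : ℕ} (hq : 1 < q) (hn : 1 ≤ n) :
    ∃ f : CubeFn F n, f ≠ 0 ∧ f ∈ lowDeg F n ((n + q - 1) / q) ∧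
      ∀ b, q ∣ (univ.filter fun i => b i = true).card → f b = 0 := by
  classical
  rcases Nat.lt_or_ge n 2 with h2 | h2
  · -- `n = 1`: `f = x₁`
    obtain rfl : n = 1 := by omega
    have hdeg : (1 + q - 1) / q = 1 := by
      rw [show 1 + q - 1 = q by omega, Nat.div_self (by omega)]
    refine ⟨mono F {0}, ?_, ?_, ?_⟩
    · intro h
      have := congrFun h (fun _ => true)
      simp [mono_apply] at this
    · rw [hdeg]
      exact mono_mem_lowDeg (by simp)
    · intro b hb
      have hle : (univ.filter fun i : Fin 1 => b i = true).card ≤ 1 := by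
        simpa using Finset.card_filter_le (univ : Finset (Fin 1)) (fun i => b i = true)
      have hne1 : (univ.filter fun i : Fin 1 => b i = true).card ≠ 1 := by
        intro h1
        rw [h1] at hb
        exact absurd (Nat.dvd_one.1 hb) (by omega)
      have h0 : (univ.filter fun i : Fin 1 => b i = true).card = 0 := by omega
      rw [Finset.card_eq_zero, Finset.filter_eq_empty_iff] at h0
      have hb0 : ¬ b 0 = true := h0 (Finset.mem_univ _)
      rw [mono_apply, if_neg]
      simpa using hb0
  · obtain ⟨m, rfl⟩ : ∃ m, n = m + 2 := ⟨n - 2, by omega⟩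
    have hdeg : (m + 2 + q - 1) / q = (m + 1) / q + 1 := by
      rw [show m + 2 + q - 1 = m + 1 + q by omega, Nat.add_div_right _ (by omega)]
    rw [hdeg]
    exact exists_ne_zero_mem_lowDeg_forall_dvd_card q m hq

end General

end Smolensky

end Literature.Computability.MetaComplexity
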